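import Summits.FinalStateConjecture.FinalStateConjecture.Theorems.EIHFluxBalanceInertialRecessionAnsatzDecay

/-!
# Route EIHFluxBalance — `InertialRecession`, line `sublinear-is-free-clean-window-charges`,
# stub `stub_quasiStationarity`: sharp Kerr–Schild decay and calculus of Lorentz motions

Helper file (part 1 of the kinematic reduction of the stub `stub_quasiStationarity` of the crux
`stmt-FinalStateConjecture-10166`). The stub asks for quasi-stationarity of the modulated
multi-Kerr–Schild background at the weighted rate `1 + d^{7/4}`; its lab-time derivative is LINEAR
in the painted rates `(Λ̇ᵢ, ξ̇ᵢ)` with kernels of size `Mᵢ/dᵢ` and `Mᵢ/dᵢ²`. This file supplies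
the two analytic inputs of that computation:

* `exists_norm_iteratedFDeriv_ksPert_le_pow` : the SHARP decay
  `‖Dᵐ(g_{M,a} − η)(x)‖ ≤ |M| Bₘ / ‖x̲‖^{m+1}` for `‖x̲‖ ≥ max 1 (2|a|)` (the library's
  `Kerr.norm_iteratedFDeriv_ksPert_le` only records `O(1/r)`); specialised to `m = 0, 1`
  (`exists_norm_ksPert_le`, `exists_norm_iteratedFDeriv_one_ksPert_le`);
* the calculus of a smooth Lorentz motion `s ↦ Λ(s)`: smoothness of the inverse path
  `s ↦ Λ(s)⁻¹` (`contDiff_lorentz_symm`), its derivative `−Λ⁻¹ Λ̇ Λ⁻¹`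
  (`hasDerivAt_lorentz_symm`), and the fact that the body-frame velocity `ω = Λ⁻¹Λ̇` is
  `η`-antisymmetric (`minkowski_bodyRate_antisymm`) — O'Neill 1983, Ch. 9.
-/


noncomputable section

namespace Summit.FinalStateConjecture.FinalStateConjecture.Theorems.SublinearIsFree.QuasiStationarity

open scoped BigOperators Topology ContDiff
open Filter Set Function Literature.Geometry.Lorentzian
open Summit.FinalStateConjecture.FinalStateConjecture.Theorems

/-! ### Sharp decay of all derivatives of the Kerr–Schild perturbation -/

-- the algebraic and the operator-norm instance paths on `E4 →L[ℝ] E4 →L[ℝ] ℝ` unify slowly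
set_option synthInstance.maxHeartbeats 200000 in
/-- **Sharp decay of all derivatives of the Kerr–Schild perturbation at spatial infinity**: for
every order `m` there is `B ≥ 0` with `‖Dᵐ (g_{M,a} − η)(x)‖ ≤ |M| B / ‖x̲‖^{m+1}` whenever
`‖x̲‖ ≥ max 1 (2|a|)`, uniformly in `(M, a)`. Proof by scaling exactly as in
`Kerr.norm_iteratedFDeriv_ksPert_le` (with `ε = 1/‖x̲‖`,
`(g_{M,a} − η) = ε M (g_{1,εa} − η) ∘ (ε ·)`), keeping the factor `|ε|ᵐ` of the chain rule instead
of discarding it. Kerr–Schild 1965, §3 (asymptotic flatness of the Kerr–Schild form).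
[cite: KerrSchild1965, §3] -/
theorem exists_norm_iteratedFDeriv_ksPert_le_pow (m : ℕ) :
    ∃ B : ℝ, 0 ≤ B ∧ ∀ (M a : ℝ) (x : E4), max 1 (2 * |a|) ≤ E4.spatialNorm x →
      ‖iteratedFDeriv ℝ m (fun y ↦ Kerr.bilin M a y - Minkowski.bilin) x‖ ≤
        |M| * B / E4.spatialNorm x ^ (m + 1) := by
  obtain ⟨B, hB⟩ := Kerr.exists_bound_iteratedFDeriv_ksPert_one m
  refine ⟨max B 0, le_max_right _ _, fun M a x hx ↦ ?_⟩
  set s := E4.spatialNorm x with hs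
  have hs1 : 1 ≤ s := (le_max_left _ _).trans hx
  have hs0 : 0 < s := one_pos.trans_le hs1
  have hsa : 2 * |a| ≤ s := (le_max_right _ _).trans hx
  set ε := s⁻¹ with hε
  have hε0 : 0 < ε := inv_pos.mpr hs0
  -- zero the time coordinate
  set x' : E4 := x - x 0 • E4.basisVector 0 with hx'
  have hsp : E4.spatial x = E4.spatial x' := by
    have h0 : E4.spatial (E4.basisVector 0) = 0 := by
      ext i
      simp [E4.spatial_apply]
    rw [hx', map_sub, map_smul, h0, smul_zero, sub_zero]
  have hder := Kerr.iteratedFDeriv_ksPert_eq_of_spatial_eq M a m hsp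
  have hsx' : E4.spatialNorm x' = s := by rw [hs, E4.spatialNorm, E4.spatialNorm, hsp]
  -- the rescaled point on the unit shell
  set y : E4 := ε • x' with hy
  have hy0 : y 0 = 0 := by simp [hy, hx']
  have hy1 : E4.spatialNorm y = 1 := by
    rw [hy, Kerr.spatialNorm_smul, abs_of_pos hε0, hsx', hε, inv_mul_cancel₀ hs0.ne']
  have ha' : |ε * a| ≤ 1 / 2 := by
    rw [abs_mul, abs_of_pos hε0, hε, inv_mul_le_iff₀ hs0]
    linarith
  have hry : 0 < Kerr.radius (ε * a) y := by
    refine Kerr.radius_pos_of_abs_lt ?_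
    rw [hy1]
    linarith
  have hfun : (fun y ↦ Kerr.bilin M a y - Minkowski.bilin) =
      fun z ↦ (ε * M) • (Kerr.bilin 1 (ε * a) (ε • z) - Minkowski.bilin) :=
    funext fun z ↦ Kerr.ksPert_smul hε0 M a z
  have hkey := norm_iteratedFDeriv_const_smul_comp_smul_le
    (fun y ↦ Kerr.bilin 1 (ε * a) y - Minkowski.bilin) (ε * M) hε0.ne' x' (m := m)
    (Kerr.contDiffAt_ksPert (M := 1) hry)
  have hB0 : 0 ≤ max B 0 := le_max_right _ _
  calc ‖iteratedFDeriv ℝ m (fun y ↦ Kerr.bilin M a y - Minkowski.bilin) x‖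
        = ‖iteratedFDeriv ℝ m (fun y ↦ Kerr.bilin M a y - Minkowski.bilin) x'‖ := by rw [hder]
    _ = ‖iteratedFDeriv ℝ m
          (fun z ↦ (ε * M) • (Kerr.bilin 1 (ε * a) (ε • z) - Minkowski.bilin)) x'‖ := by
        rw [← hfun]
    _ ≤ |ε * M| * |ε| ^ m *
          ‖iteratedFDeriv ℝ m (fun y ↦ Kerr.bilin 1 (ε * a) y - Minkowski.bilin) y‖ := hkey
    _ ≤ |ε * M| * |ε| ^ m * max B 0 := by
        gcongr
        exact (hB _ ha' y hy0 hy1).trans (le_max_left _ _)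
    _ = |M| * max B 0 * ε ^ (m + 1) := by
        rw [abs_mul, abs_of_pos hε0]
        ring
    _ = |M| * max B 0 / s ^ (m + 1) := by
        rw [hε, inv_pow, div_eq_mul_inv]

/-- The order-`0` constant `B₀ ≥ 0` of `exists_norm_iteratedFDeriv_ksPert_le_pow`:
`‖g_{M,a}(x) − η‖ ≤ |M| B₀ / ‖x̲‖` for `‖x̲‖ ≥ max 1 (2|a|)` (Kerr–Schild 1965, §3).
[cite: KerrSchild1965, §3] -/
theorem exists_norm_ksPert_le :
    ∃ B₀ : ℝ, 0 ≤ B₀ ∧ ∀ (M a : ℝ) (x : E4), max 1 (2 * |a|) ≤ E4.spatialNorm x →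
      ‖Kerr.bilin M a x - Minkowski.bilin‖ ≤ |M| * B₀ / E4.spatialNorm x := by
  obtain ⟨B, hB0, hB⟩ := exists_norm_iteratedFDeriv_ksPert_le_pow 0
  refine ⟨B, hB0, fun M a x hx ↦ ?_⟩
  have h := hB M a x hx
  rwa [norm_iteratedFDeriv_zero, zero_add, pow_one] at h

-- the operator-norm instance path on form-valued multilinear maps is slow to unify
set_option synthInstance.maxHeartbeats 200000 in
/-- The order-`1` constant `B₁ ≥ 0` of `exists_norm_iteratedFDeriv_ksPert_le_pow`:
`‖D(g_{M,a} − η)(x)‖ ≤ |M| B₁ / ‖x̲‖²` for `‖x̲‖ ≥ max 1 (2|a|)` — the `M/d²` size of the gradient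
of the Kerr–Schild perturbation (Kerr–Schild 1965, §3). Stated with `iteratedFDeriv ℝ 1` (whose
operator norm Lean finds) rather than `fderiv` (a map into a space of bilinear forms, whose norm
instance Lean does not find); see `norm_fderiv_apply_le_of_iteratedFDeriv_one`.
[cite: KerrSchild1965, §3] -/
theorem exists_norm_iteratedFDeriv_one_ksPert_le :
    ∃ B₁ : ℝ, 0 ≤ B₁ ∧ ∀ (M a : ℝ) (x : E4), max 1 (2 * |a|) ≤ E4.spatialNorm x →
      ‖iteratedFDeriv ℝ 1 (fun y ↦ Kerr.bilin M a y - Minkowski.bilin) x‖ ≤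
        |M| * B₁ / E4.spatialNorm x ^ 2 :=
  exists_norm_iteratedFDeriv_ksPert_le_pow 1

-- the operator-norm instance path on form-valued multilinear maps is slow to unify
set_option synthInstance.maxHeartbeats 200000 in
/-- **The first derivative through `iteratedFDeriv ℝ 1`**: `‖Df(x) u‖ ≤ ‖D¹f(x)‖ ‖u‖` for a map
into bilinear forms (Mathlib's `iteratedFDeriv_one_apply`; this is how the gradient bound
`exists_norm_iteratedFDeriv_one_ksPert_le` is consumed). [folklore] -/
theorem norm_fderiv_apply_le_of_iteratedFDeriv_one (f : E4 → E4 →L[ℝ] E4 →L[ℝ] ℝ) (x u : E4) :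
    ‖fderiv ℝ f x u‖ ≤ ‖iteratedFDeriv ℝ 1 f x‖ * ‖u‖ := by
  have h := (iteratedFDeriv ℝ 1 f x).le_opNorm ![u]
  rw [iteratedFDeriv_one_apply] at h
  simpa using h

/-- `|a| < max 1 (2|a|)`: a point at spatial distance `≥ max 1 (2|a|)` is off the Kerr ring, so the
Kerr–Schild form is smooth there (bookkeeping). [folklore] -/
theorem abs_lt_max_one_two_mul_abs (a : ℝ) : |a| < max 1 (2 * |a|) := by
  rcases lt_or_ge |a| 1 with h | h
  · exact h.trans_le (le_max_left _ _)
  · have : |a| < 2 * |a| := by linarith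
    exact this.trans_le (le_max_right _ _)

/-- The Kerr–Schild perturbation is differentiable at every point with `‖x̲‖ ≥ max 1 (2|a|)`
(Kerr–Schild 1965, §3: smoothness off the ring). [cite: KerrSchild1965, §3] -/
theorem differentiableAt_ksPert_of_le {M a : ℝ} {x : E4} (hx : max 1 (2 * |a|) ≤ E4.spatialNorm x) :
    DifferentiableAt ℝ (fun y ↦ Kerr.bilin M a y - Minkowski.bilin) x :=
  (Kerr.contDiffAt_ksPert (n := 1)
    (Kerr.radius_pos_of_abs_lt ((abs_lt_max_one_two_mul_abs a).trans_le hx))).differentiableAt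
    one_ne_zero

/-! ### Calculus of a smooth Lorentz motion: the inverse path and the body-frame rate -/

/-- The inverse path of a Lorentz motion, `s ↦ Λ(s)⁻¹` as operators, is the composition of the
operator path with operator inversion (Mathlib's `ContinuousLinearMap.inverse`). [folklore] -/
theorem lorentz_symm_eq_inverse_comp (Λ : ℝ → lorentzGroup) :
    (fun s ↦ (((Λ s : E4 ≃L[ℝ] E4).symm : E4 →L[ℝ] E4))) =
      ContinuousLinearMap.inverse ∘ fun s ↦ ((Λ s : E4 ≃L[ℝ] E4) : E4 →L[ℝ] E4) := by
  funext s
  simp only [Function.comp_apply, ContinuousLinearMap.inverse_equiv]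

/-- **The inverse path of a `Cⁿ` Lorentz motion is `Cⁿ`** (operator inversion is smooth at
invertible operators; Mathlib's `contDiffAt_map_inverse`). [folklore] -/
theorem contDiff_lorentz_symm {Λ : ℝ → lorentzGroup} {n : WithTop ℕ∞}
    (hΛ : ContDiff ℝ n (fun s ↦ ((Λ s : E4 ≃L[ℝ] E4) : E4 →L[ℝ] E4))) :
    ContDiff ℝ n (fun s ↦ (((Λ s : E4 ≃L[ℝ] E4).symm : E4 →L[ℝ] E4))) := by
  rw [lorentz_symm_eq_inverse_comp]
  exact contDiff_iff_contDiffAt.mpr fun s ↦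
    (contDiffAt_map_inverse (Λ s : E4 ≃L[ℝ] E4)).comp s hΛ.contDiffAt

/-- **Derivative of the inverse path**: if `s ↦ Λ(s)` (as operators) has derivative `Λ̇` at `t`,
then `s ↦ Λ(s)⁻¹` has derivative `−Λ(t)⁻¹ Λ̇ Λ(t)⁻¹` at `t` (differentiate `Λ⁻¹ Λ = 1`).
[folklore] -/
theorem hasDerivAt_lorentz_symm {Λ : ℝ → lorentzGroup} {n : WithTop ℕ∞} (hn : n ≠ 0)
    (hΛ : ContDiff ℝ n (fun s ↦ ((Λ s : E4 ≃L[ℝ] E4) : E4 →L[ℝ] E4))) {t : ℝ}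
    {Λ' : E4 →L[ℝ] E4} (hΛ' : HasDerivAt (fun s ↦ ((Λ s : E4 ≃L[ℝ] E4) : E4 →L[ℝ] E4)) Λ' t) :
    HasDerivAt (fun s ↦ (((Λ s : E4 ≃L[ℝ] E4).symm : E4 →L[ℝ] E4)))
      (-((((Λ t : E4 ≃L[ℝ] E4).symm : E4 →L[ℝ] E4)).comp
        (Λ'.comp (((Λ t : E4 ≃L[ℝ] E4).symm : E4 →L[ℝ] E4))))) t := by
  set A : ℝ → E4 →L[ℝ] E4 := fun s ↦ (((Λ s : E4 ≃L[ℝ] E4).symm : E4 →L[ℝ] E4)) with hA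
  have hAd : DifferentiableAt ℝ A t :=
    ((contDiff_lorentz_symm hΛ).differentiable hn t)
  have hAder : HasDerivAt A (deriv A t) t := hAd.hasDerivAt
  -- differentiate `A s ∘ Λ s = 1`
  have hprod : HasDerivAt (fun s ↦ (A s).comp ((Λ s : E4 ≃L[ℝ] E4) : E4 →L[ℝ] E4))
      ((deriv A t).comp ((Λ t : E4 ≃L[ℝ] E4) : E4 →L[ℝ] E4) + (A t).comp Λ') t :=
    hAder.clm_comp hΛ'
  have hconst : (fun s ↦ (A s).comp ((Λ s : E4 ≃L[ℝ] E4) : E4 →L[ℝ] E4)) =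
      fun _ ↦ ContinuousLinearMap.id ℝ E4 := by
    funext s
    ext v
    simp [hA]
  rw [hconst] at hprod
  have hzero : (deriv A t).comp ((Λ t : E4 ≃L[ℝ] E4) : E4 →L[ℝ] E4) + (A t).comp Λ' = 0 :=
    hprod.unique (hasDerivAt_const t _)
  have hval : deriv A t = -((A t).comp (Λ'.comp (A t))) := by
    refine ContinuousLinearMap.ext fun v ↦ ?_
    have h := congrArg (fun T : E4 →L[ℝ] E4 ↦ T ((A t) v)) hzero
    simp only [add_apply, ContinuousLinearMap.coe_comp, Function.comp_apply,
      zero_apply, hA, ContinuousLinearEquiv.coe_coe,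
      ContinuousLinearEquiv.apply_symm_apply] at h
    simp only [neg_apply, ContinuousLinearMap.coe_comp, Function.comp_apply,
      hA, ContinuousLinearEquiv.coe_coe]
    exact eq_neg_of_add_eq_zero_left h
  rw [hval] at hAder
  exact hAder

-- the algebraic and the operator-norm instance paths on `E4 →L[ℝ] E4 →L[ℝ] ℝ` unify slowly
set_option synthInstance.maxHeartbeats 200000 in
/-- Registered sub-goal form (stub `ksPert_sharp_decay` of the crux item) of
`exists_norm_iteratedFDeriv_ksPert_le_pow`: sharp decay `|M| Bₘ / ‖x̲‖^{m+1}` of all derivatives of the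
Kerr–Schild perturbation (Kerr–Schild 1965, §3). [cite: KerrSchild1965, §3] -/
theorem ksPert_sharp_decay : open Literature.Geometry.Lorentzian Filter Topology in ∀ (m : ℕ), ∃ B : ℝ, 0 ≤ B ∧ ∀ (M a : ℝ) (x : E4), max 1 (2 * |a|) ≤ E4.spatialNorm x → ‖iteratedFDeriv ℝ m (fun y ↦ Kerr.bilin M a y - Minkowski.bilin) x‖ ≤ |M| * B / E4.spatialNorm x ^ (m + 1) :=
  exists_norm_iteratedFDeriv_ksPert_le_pow

end Summit.FinalStateConjecture.FinalStateConjecture.Theorems.SublinearIsFree.QuasiStationarity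

end
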